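import Literature.Algebra.Homology.FlatQuasiIsoBaseChange
import Literature.Algebra.Homology.KerZeroOfQuasiIso
import Mathlib.Algebra.Category.ModuleCat.Monoidal.Basic
import HarnessLib

/-!
# `H⁰ = Ker d⁰` under a quasi-isomorphism and under base change: the explicit maps

`Literature/Algebra/Homology/KerZeroOfQuasiIso` records that a quasi-isomorphism `ψ : P → C` of
cochain complexes of modules concentrated in degrees `≥ 0` identifies `Ker d⁰_P ≅ Ker d⁰_C`, and
`Literature/Algebra/Homology/FlatQuasiIsoBaseChange` that a quasi-isomorphism of bounded above
complexes of flat modules stays one after `M ⊗ −` (Mumford, *Abelian Varieties*, §5, Lemma 2;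
Görtz–Wedhorn II, Rem. 21.92 (2), Lemma 21.93) — both as mere existence / `QuasiIso` statements.
For the Grothendieck complex "functorial in the `A`-algebra `B`" (Görtz–Wedhorn II, Cor. 23.137)
one needs the maps themselves:

* `kerZeroMap ψ : Ker d⁰_P → Ker d⁰_C`, `v ↦ ψ⁰ v`, and `kerZeroMap_bijective` — it is a bijection
  when `ψ` is a quasi-isomorphism and `P`, `C` live in degrees `≥ 0` (it is Mathlib's
  `cyclesMap ψ 0` read through `ShortComplex.moduleCatCyclesIso`);
* `kerZeroBaseChangeMap φ B : Ker(d⁰_P ⊗ B) → Ker(d⁰_C ⊗ B)`, `v ↦ (φ⁰ ⊗ B) v`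
  (`LinearMap.baseChange`), for a morphism `φ : P → C` of complexes of `A`-modules and a
  commutative `A`-algebra `B`, with `kerZeroBaseChangeMap_bijective`: a bijection when `φ` is a
  quasi-isomorphism of complexes of flat modules concentrated in degrees `[0, N]`
  (`quasiIso_tensorLeft_map_of_flat` for the `A`-module `B`, then `kerZeroMap_bijective`), and its
  naturality in `B` (`rTensor_kerZeroBaseChangeMap`: for an `A`-algebra map `u : B → B'`,
  `(u ⊗ 1) ∘ (φ⁰ ⊗ B) = (φ⁰ ⊗ B') ∘ (u ⊗ 1)`, Mathlib `LinearMap.rTensor_baseChange`).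

Pure homological algebra over Mathlib; used by
`Literature/AlgebraicGeometry/Motives/GrothendieckComplexH0Natural`.

## References

* U. Görtz, T. Wedhorn, *Algebraic Geometry II: Cohomology of Schemes*, Springer Spektrum (2023),
  doi:10.1007/978-3-658-43031-3: Rem. 21.92 (2), Lemma 21.93, pp. 273–274; Cor. 23.137, p. 480;
  proof of Prop. 23.117, p. 466. [GortzWedhorn2023]
* D. Mumford, *Abelian Varieties*, TIFR Studies in Mathematics 5 (1970), §5, Lemma 2.
  [MumfordAV1970]
-/

universe v u

open CategoryTheory CategoryTheory.Limits HomologicalComplex MonoidalCategory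
open scoped TensorProduct

namespace Literature.Algebra.Homology

/-! ### The map `Ker d⁰_P → Ker d⁰_C` of a morphism of complexes -/

section KerZeroMap

variable {S : Type u} [Ring S] {P C : CochainComplex (ModuleCat.{v} S) ℤ} (ψ : P ⟶ C)

/-- The linear map `Ker(d⁰_P) → Ker(d⁰_C)`, `v ↦ ψ⁰ v`, induced by a morphism of cochain
complexes of modules (`d (ψ⁰ v) = ψ¹ (d v) = 0`). [folklore] -/
noncomputable def kerZeroMap :
    LinearMap.ker (P.d 0 1).hom →ₗ[S] LinearMap.ker (C.d 0 1).hom :=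
  (ψ.f 0).hom.restrict fun v hv => by
    rw [LinearMap.mem_ker] at hv ⊢
    have h := congrArg (fun g => g.hom v) (ψ.comm 0 1)
    simp only [ModuleCat.hom_comp, LinearMap.coe_comp, Function.comp_apply] at h
    rw [h, hv, map_zero]

/-- `kerZeroMap ψ v = ψ⁰ v` on underlying elements. [folklore] -/
@[simp] theorem coe_kerZeroMap_apply (v : LinearMap.ker (P.d 0 1).hom) :
    (kerZeroMap ψ v : C.X 0) = (ψ.f 0).hom v := rfl

/-- The underlying element of `kerDEquivOfEq` is unchanged. [folklore] -/
theorem coe_kerDEquivOfEq_apply (K : CochainComplex (ModuleCat.{v} S) ℤ) (i : ℤ) {j j' : ℤ}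
    (e : j = j') (v : LinearMap.ker (K.d i j).hom) :
    ((kerDEquivOfEq K i e v : LinearMap.ker (K.d i j').hom) : K.X i) = v := by
  subst e
  rfl

/-- The underlying element of `(kerDEquivOfEq …).symm` is unchanged. [folklore] -/
theorem coe_kerDEquivOfEq_symm_apply (K : CochainComplex (ModuleCat.{v} S) ℤ) (i : ℤ) {j j' : ℤ}
    (e : j = j') (v : LinearMap.ker (K.d i j').hom) :
    (((kerDEquivOfEq K i e).symm v : LinearMap.ker (K.d i j).hom) : K.X i) = v := by
  subst e
  rfl

/-- `cyclesZeroEquivKer` is `iCycles` on underlying elements. [folklore] -/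
theorem coe_cyclesZeroEquivKer_apply (K : CochainComplex (ModuleCat.{v} S) ℤ) (c : K.cycles 0) :
    ((cyclesZeroEquivKer K c : LinearMap.ker (K.d 0 1).hom) : K.X 0) = K.iCycles 0 c := by
  change ((kerDEquivOfEq K 0 (CochainComplex.next ℤ 0)
    ((K.sc 0).moduleCatCyclesIso.toLinearEquiv c) : LinearMap.ker (K.d 0 1).hom) : K.X 0) = _
  rw [coe_kerDEquivOfEq_apply]
  exact ShortComplex.moduleCatCyclesIso_hom_i_apply (K.sc 0) c

/-- `iCycles ∘ cyclesZeroEquivKer⁻¹` is the inclusion of the kernel. [folklore] -/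
theorem iCycles_cyclesZeroEquivKer_symm_apply (K : CochainComplex (ModuleCat.{v} S) ℤ)
    (v : LinearMap.ker (K.d 0 1).hom) :
    K.iCycles 0 ((cyclesZeroEquivKer K).symm v) = (v : K.X 0) := by
  have h := coe_cyclesZeroEquivKer_apply K ((cyclesZeroEquivKer K).symm v)
  rw [LinearEquiv.apply_symm_apply] at h
  exact h.symm

/-- **A quasi-isomorphism of complexes of modules in degrees `≥ 0` induces a bijection
`Ker d⁰_P → Ker d⁰_C`, `v ↦ ψ⁰ v`** (`H⁰ = Ker d⁰`; Görtz–Wedhorn II, p. 466). [folklore] -/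
theorem kerZeroMap_bijective [QuasiIso ψ] [P.IsStrictlyGE 0] [C.IsStrictlyGE 0] :
    Function.Bijective (kerZeroMap ψ) := by
  have hP0 : P.d (-1) 0 = 0 := (P.isZero_of_isStrictlyGE 0 (-1) (by omega)).eq_of_src _ _
  have hC0 : C.d (-1) 0 = 0 := (C.isZero_of_isStrictlyGE 0 (-1) (by omega)).eq_of_src _ _
  haveI := P.isIso_homologyπ (-1) 0 (by simp) hP0
  haveI := C.isIso_homologyπ (-1) 0 (by simp) hC0
  haveI : IsIso (homologyMap ψ 0) := by
    rw [← quasiIsoAt_iff_isIso_homologyMap]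
    infer_instance
  have hc : IsIso (cyclesMap ψ 0) := by
    have e : cyclesMap ψ 0 = P.homologyπ 0 ≫ homologyMap ψ 0 ≫ inv (C.homologyπ 0) := by
      rw [← Category.assoc, homologyπ_naturality, Category.assoc, IsIso.hom_inv_id,
        Category.comp_id]
    rw [e]
    infer_instance
  -- the explicit linear equivalence with the same underlying function
  let E : LinearMap.ker (P.d 0 1).hom ≃ₗ[S] LinearMap.ker (C.d 0 1).hom :=
    (cyclesZeroEquivKer P).symm.trans
      ((asIso (cyclesMap ψ 0)).toLinearEquiv.trans (cyclesZeroEquivKer C))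
  have hE : ∀ v, (E v : C.X 0) = (kerZeroMap ψ v : C.X 0) := by
    intro v
    change ((cyclesZeroEquivKer C) ((cyclesMap ψ 0) ((cyclesZeroEquivKer P).symm v)) : C.X 0) = _
    rw [coe_cyclesZeroEquivKer_apply, coe_kerZeroMap_apply]
    have h := HomologicalComplex.cyclesMap_i ψ 0
    have h' := congrArg (fun g => g.hom ((cyclesZeroEquivKer P).symm v)) h
    simp only [ModuleCat.hom_comp, LinearMap.coe_comp, Function.comp_apply] at h'
    rw [h', iCycles_cyclesZeroEquivKer_symm_apply]
  have hfun : (E : LinearMap.ker (P.d 0 1).hom → LinearMap.ker (C.d 0 1).hom) = kerZeroMap ψ := by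
    funext v
    exact Subtype.ext (hE v)
  rw [← hfun]
  exact E.bijective

end KerZeroMap

/-! ### Base change: `Ker(d⁰_P ⊗ B) → Ker(d⁰_C ⊗ B)` -/

section BaseChange

variable {A : Type u} [CommRing A] {P C : CochainComplex (ModuleCat.{u} A) ℤ} (φ : P ⟶ C)
  (B : Type u) [CommRing B] [Algebra A B]

/-- The `B`-linear map `Ker(d⁰_P ⊗ B) → Ker(d⁰_C ⊗ B)`, `v ↦ (φ⁰ ⊗ B) v`, induced by a morphism of
complexes of `A`-modules after the base change `B ⊗_A −` (Mathlib `LinearMap.baseChange`).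
[folklore] -/
noncomputable def kerZeroBaseChangeMap :
    LinearMap.ker ((P.d 0 1).hom.baseChange B) →ₗ[B] LinearMap.ker ((C.d 0 1).hom.baseChange B) :=
  ((φ.f 0).hom.baseChange B).restrict fun v hv => by
    rw [LinearMap.mem_ker] at hv ⊢
    rw [← LinearMap.comp_apply, ← LinearMap.baseChange_comp]
    have h := congrArg ModuleCat.Hom.hom (φ.comm 0 1)
    simp only [ModuleCat.hom_comp] at h
    rw [h, LinearMap.baseChange_comp, LinearMap.comp_apply, hv, map_zero]

/-- `kerZeroBaseChangeMap φ B v = (φ⁰ ⊗ B) v` on underlying elements. [folklore] -/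
@[simp] theorem coe_kerZeroBaseChangeMap_apply (v : LinearMap.ker ((P.d 0 1).hom.baseChange B)) :
    (kerZeroBaseChangeMap φ B v : B ⊗[A] C.X 0) = (φ.f 0).hom.baseChange B v := rfl

/-- `u ⊗ 1` maps `Ker(f ⊗ B)` into `Ker(f ⊗ B')`. [folklore] -/
theorem rTensor_mem_ker_baseChange {B' : Type u} [CommRing B'] [Algebra A B'] (u : B →ₐ[A] B')
    {M N : Type*} [AddCommGroup M] [Module A M] [AddCommGroup N] [Module A N] (f : M →ₗ[A] N)
    {z : B ⊗[A] M} (hz : z ∈ LinearMap.ker (f.baseChange B)) :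
    u.toLinearMap.rTensor M z ∈ LinearMap.ker (f.baseChange B') := by
  rw [LinearMap.mem_ker] at hz ⊢
  rw [← LinearMap.rTensor_baseChange, hz, map_zero]

/-- Naturality of `kerZeroBaseChangeMap` in the algebra `B`, on underlying elements. [folklore] -/
theorem rTensor_kerZeroBaseChangeMap {B' : Type u} [CommRing B'] [Algebra A B'] (u : B →ₐ[A] B')
    (v : LinearMap.ker ((P.d 0 1).hom.baseChange B))
    (v' : LinearMap.ker ((P.d 0 1).hom.baseChange B'))
    (hv : (v' : B' ⊗[A] P.X 0) = u.toLinearMap.rTensor (P.X 0) (v : B ⊗[A] P.X 0)) :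
    (kerZeroBaseChangeMap φ B' v' : B' ⊗[A] C.X 0) =
      u.toLinearMap.rTensor (C.X 0) (kerZeroBaseChangeMap φ B v : B ⊗[A] C.X 0) := by
  rw [coe_kerZeroBaseChangeMap_apply, coe_kerZeroBaseChangeMap_apply, hv,
    LinearMap.rTensor_baseChange]

/-- **Base change of a quasi-isomorphism of bounded complexes of flat modules, in degree `0`**
(Mumford, *Abelian Varieties*, §5, Lemma 2 with "`H⁰ = Ker d⁰`"; Görtz–Wedhorn II, Rem. 21.92 (2),
Lemma 21.93): if `φ : P → C` is a quasi-isomorphism of complexes of flat `A`-modules concentrated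
in degrees `[0, N]`, then for every commutative `A`-algebra `B` the map
`Ker(d⁰_P ⊗ B) → Ker(d⁰_C ⊗ B)`, `v ↦ (φ⁰ ⊗ B) v`, is bijective.
[cite: GortzWedhorn2023, Rem. 21.92 (2) and Lemma 21.93 (pp. 273–274)] -/
theorem kerZeroBaseChangeMap_bijective [QuasiIso φ] (hP : ∀ n, Module.Flat A (P.X n))
    (hC : ∀ n, Module.Flat A (C.X n)) (N : ℤ) [P.IsStrictlyLE N] [C.IsStrictlyLE N]
    [P.IsStrictlyGE 0] [C.IsStrictlyGE 0] :
    Function.Bijective (kerZeroBaseChangeMap φ B) := by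
  let M : ModuleCat.{u} A := ModuleCat.of A B
  haveI := quasiIso_tensorLeft_map_of_flat φ hP hC N M
  let ψ := ((tensorLeft M).mapHomologicalComplex (ComplexShape.up ℤ)).map φ
  have hbij := kerZeroMap_bijective ψ
  -- the terms and differentials of `B ⊗ P`, `B ⊗ C` (Mathlib `tensorLeft`) are `B ⊗_A Pⁿ`, `1 ⊗ d`
  have hdP : ∀ z : B ⊗[A] P.X 0,
      ((((tensorLeft M).mapHomologicalComplex (ComplexShape.up ℤ)).obj P).d 0 1).hom z =
        (P.d 0 1).hom.baseChange B z := fun z => by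
    rw [LinearMap.baseChange_eq_ltensor]
    rfl
  have hdC : ∀ z : B ⊗[A] C.X 0,
      ((((tensorLeft M).mapHomologicalComplex (ComplexShape.up ℤ)).obj C).d 0 1).hom z =
        (C.d 0 1).hom.baseChange B z := fun z => by
    rw [LinearMap.baseChange_eq_ltensor]
    rfl
  have hψ : ∀ z : B ⊗[A] P.X 0, (ψ.f 0).hom z = (φ.f 0).hom.baseChange B z := fun z => by
    rw [LinearMap.baseChange_eq_ltensor]
    rfl
  -- the kernels of `d⁰ ⊗ B` as `A`-submodules (terms of `B ⊗ P`) and as `B`-submodules agree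
  let eP : LinearMap.ker ((((tensorLeft M).mapHomologicalComplex (ComplexShape.up ℤ)).obj P).d 0 1).hom
      ≃ LinearMap.ker ((P.d 0 1).hom.baseChange B) :=
    Equiv.subtypeEquiv (Equiv.refl (B ⊗[A] P.X 0)) fun z => by
      simp only [LinearMap.mem_ker]
      constructor
      · intro h; rw [← hdP]; exact h
      · intro h; rw [hdP]; exact h
  let eC : LinearMap.ker ((((tensorLeft M).mapHomologicalComplex (ComplexShape.up ℤ)).obj C).d 0 1).hom
      ≃ LinearMap.ker ((C.d 0 1).hom.baseChange B) :=
    Equiv.subtypeEquiv (Equiv.refl (B ⊗[A] C.X 0)) fun z => by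
      simp only [LinearMap.mem_ker]
      constructor
      · intro h; rw [← hdC]; exact h
      · intro h; rw [hdC]; exact h
  have hfun : (kerZeroBaseChangeMap φ B : _ → _) = eC ∘ kerZeroMap ψ ∘ eP.symm := by
    funext v
    apply Subtype.ext
    exact (hψ _).symm
  rw [hfun]
  exact eC.bijective.comp (hbij.comp eP.symm.bijective)

end BaseChange

end Literature.Algebra.Homology
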